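import Literature.MathematicalPhysics.KineticTheory.LangevinChainScaleCloseness
import Mathlib.Analysis.SpecialFunctions.Trigonometric.Deriv
import HarnessLib

/-!
# The pinning-dominated regime (`lam = 0`): the centre of mass and the high-energy dissipation bound (CEHR §5.2)

Trunk T-KINETIC (Literature/MathematicalPhysics/KineticTheory). Deterministic layer of the
provefact unit for `CuneoEckmannHairerReyBellet2018_H2` (CEHR Theorem 5.1 / Remark 5.2),
companion of `LangevinChainScaleCloseness.lean` (the interaction-dominated regime).
Cuneo–Eckmann–Hairer–Rey-Bellet, EJP 23 (2018) no. 55, §5.2 "When the pinning dominates"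
(arXiv pp. 15–16): for `ℓ_i > ℓ_p` — here the pinned chain with `lam = 0`, harmonic pinning
`ω₂q²/2` (`ℓ_p = 2`) and quartic coupling (`ℓ_i = 4`) — initial conditions whose energy sits in
the pinning/centre-of-mass degrees of freedom are treated on the pinning time scale
`τ = λH^{1/ℓ_p - 1/2} = λ` (a window of ORDER ONE), through the centre of mass (5.15)–(5.16)
("as the interaction forces cancel out"), its limiting oscillator (5.18), Prop. 5.21 (the limit
oscillator moves) and Lemma 5.22 (if the bath momenta are small in `L²` the centre of mass cannot
move — contradiction). This file PROVES the pathwise version for the pinned chain: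

* `OscillatorChain.sum_dPotential`, `pinnedChain_sum_dPotential_harmonic` — the interaction
  forces cancel in the total force; for `lam = 0` the mean force is `ω₂Q̄`.
* `oscQ`, `oscV`, `osc_data_le` — the free oscillator `Q̂ = Q₀cos ωt + (V₀/ω)sin ωt` and the
  explicit form of Prop. 5.21: `|Q₀| ≤ (|f₂| + 2|f₁|)/(2(1 - cos θ))` for the displacements
  `f_k = Q̂(kθ/ω) - Q₀`, `0 < θ ≤ 1`.
* `pinnedChain_cm_potential_lower` — in the regime `K⁴ ≤ H(x) ≤ 2K⁴`, `Ĥ(rescale K x) < 1/2`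
  (kinetic + quartic bond energy below half) the centre of mass carries `Nω₂Q̄₀²/2 ≥ K⁴/8` for
  `K` large (the role of `Ĥ(P̃₀,Q̃₀) ∈ [1/4, 2]`).
* `linear_energy_estimate` — energy method for the forced oscillator `D₁' = D₂ + a`,
  `D₂' = -ω₂D₁ + b`: `ω₂D₁² + D₂² ≤ e^T∫₀ᵀ(ω₂a² + b²)` (Lemma 5.8 for this linear system).
* `pinnedChain_window_bounds` — bounds over a window of order one from the energy ceiling of
  `LangevinChainEnergyScale.lean` (`AδT ≤ 1`).
* `pinnedChain_dissipation_ge_pinning` — **the dissipation bound in the pinning regime**: for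
  `T > 0`, `δ₀ ∈ (0,1]`, `Aδ₀T ≤ 1` there are `K₀, ε > 0` with `γ∫₀ᵀ∑ᵢwᵢȳᵢ² ≥ εK⁴` whenever
  `K ≥ K₀`, `K⁴ ≤ H(x) ≤ 2K⁴`, `Ĥ(rescale K x) < 1/2`, `‖η‖ ≤ δ₀K` on `[0, T]` (Lemma 5.22's
  chain of inequalities, with the `L²`-smallness `X < ε` replaced by the contradiction hypothesis
  `γ∫∑wȳ² < ξK⁴`).

## References

* N. Cuneo, J.-P. Eckmann, M. Hairer, L. Rey-Bellet, *Non-equilibrium steady states for networks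
  of oscillators*, EJP 23 (2018) no. 55 (arXiv:1712.09413), §5.2: (5.13)–(5.19), Lemma 5.20,
  Prop. 5.21, Lemma 5.22; Prop. 5.3; Lemma 5.8.
-/

noncomputable section

open MeasureTheory Filter Topology Set Metric Function
open scoped NNReal

namespace Literature.MathematicalPhysics.KineticTheory.HeatConduction

open OscillatorChain Literature.Analysis.ODE

variable {N : ℕ}

/-! ### The interaction forces cancel in the total force -/

/-- **The total force is the total pinning force**: `∑_i ∂Φ/∂q_i = ∑_i U'(q_i)` — the bond terms
`V'(q_l - q_k)([l=i] - [k=i])` cancel when summed over `i` (action–reaction; CEHR (5.16): "as the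
interaction forces cancel out"). [cite: CuneoEckmannHairerReyBellet2018, §5.2 eq. (5.16)] -/
theorem OscillatorChain.sum_dPotential (P : OscillatorChain) (N : ℕ) (q : Fin N → ℝ) :
    ∑ i, P.dPotential N i q = ∑ i, deriv P.U (q i) := by
  unfold OscillatorChain.dPotential
  rw [Finset.sum_add_distrib]
  suffices h : ∑ i : Fin N, ∑ k : Fin N, ∑ l : Fin N, (if l.val = k.val + 1 then
      deriv P.V (q l - q k) * ((if l = i then 1 else 0) - (if k = i then 1 else 0)) else 0) = 0 by
    rw [h, add_zero]
  rw [Finset.sum_comm]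
  refine Finset.sum_eq_zero fun k _ => ?_
  rw [Finset.sum_comm]
  refine Finset.sum_eq_zero fun l _ => ?_
  by_cases h : l.val = k.val + 1
  · simp only [h, if_true]
    rw [← Finset.mul_sum, Finset.sum_sub_distrib, Finset.sum_ite_eq Finset.univ l,
      Finset.sum_ite_eq Finset.univ k]
    simp
  · simp [h]

/-- For the pinned chain with harmonic pinning only (`lam = 0`), the mean force is harmonic in the
centre of mass: `(1/N) ∑_i ∂Φ/∂q_i = ω₂ Q̄`, `Q̄ = (1/N)∑ q_i`.
[cite: CuneoEckmannHairerReyBellet2018, §5.2 eq. (5.16)] -/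
theorem pinnedChain_sum_dPotential_harmonic (ω₂ β γ : ℝ) (N : ℕ) (q : Fin N → ℝ) :
    ∑ i, (pinnedChain ω₂ 0 β γ).dPotential N i q = ω₂ * ∑ i, q i := by
  rw [(pinnedChain ω₂ 0 β γ).sum_dPotential, Finset.mul_sum]
  refine Finset.sum_congr rfl fun i _ => ?_
  rw [pinnedChain_deriv_U]
  ring

/-! ### The free harmonic oscillator of the centre of mass -/

/-- Position of the free oscillator `Q'' = -ω²Q` with data `(Q₀, V₀)`:
`Q̂(t) = Q₀ cos ωt + (V₀/ω) sin ωt` (CEHR (5.18), the limiting system of the pinning regime, here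
exactly solvable). [cite: CuneoEckmannHairerReyBellet2018, §5.2 eq. (5.18)] -/
def oscQ (ω Q₀ V₀ t : ℝ) : ℝ := Q₀ * Real.cos (ω * t) + V₀ / ω * Real.sin (ω * t)

/-- Velocity of the free oscillator: `V̂(t) = -Q₀ω sin ωt + V₀ cos ωt`. [folklore] -/
def oscV (ω Q₀ V₀ t : ℝ) : ℝ := -(Q₀ * ω) * Real.sin (ω * t) + V₀ * Real.cos (ω * t)

section Oscillator

variable (ω Q₀ V₀ : ℝ)

/-- `Q̂(0) = Q₀`. [folklore] -/
@[simp] theorem oscQ_zero : oscQ ω Q₀ V₀ 0 = Q₀ := by simp [oscQ]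

/-- `V̂(0) = V₀`. [folklore] -/
@[simp] theorem oscV_zero : oscV ω Q₀ V₀ 0 = V₀ := by simp [oscV]

/-- `Q̂' = V̂` (`ω ≠ 0`). [folklore] -/
theorem hasDerivAt_oscQ (hω : ω ≠ 0) (t : ℝ) : HasDerivAt (oscQ ω Q₀ V₀) (oscV ω Q₀ V₀ t) t := by
  unfold oscQ oscV
  have h1 : HasDerivAt (fun t => Real.cos (ω * t)) (-Real.sin (ω * t) * ω) t := by
    have := ((hasDerivAt_id t).const_mul ω).cos
    simpa using this
  have h2 : HasDerivAt (fun t => Real.sin (ω * t)) (Real.cos (ω * t) * ω) t := by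
    have := ((hasDerivAt_id t).const_mul ω).sin
    simpa using this
  have h := (h1.const_mul Q₀).add (h2.const_mul (V₀ / ω))
  refine h.congr_deriv ?_
  field_simp

/-- `V̂' = -ω² Q̂`. [folklore] -/
theorem hasDerivAt_oscV (t : ℝ) : HasDerivAt (oscV ω Q₀ V₀) (-(ω ^ 2) * oscQ ω Q₀ V₀ t) t := by
  unfold oscQ oscV
  have h1 : HasDerivAt (fun t => Real.cos (ω * t)) (-Real.sin (ω * t) * ω) t := by
    have := ((hasDerivAt_id t).const_mul ω).cos
    simpa using this
  have h2 : HasDerivAt (fun t => Real.sin (ω * t)) (Real.cos (ω * t) * ω) t := by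
    have := ((hasDerivAt_id t).const_mul ω).sin
    simpa using this
  have h := (h2.const_mul (-(Q₀ * ω))).add (h1.const_mul V₀)
  refine h.congr_deriv ?_
  by_cases hω : ω = 0
  · simp [hω]
  · field_simp
    ring

/-- The oscillator curves are continuous. [folklore] -/
theorem continuous_oscQ : Continuous (oscQ ω Q₀ V₀) := by unfold oscQ; fun_prop

/-- The oscillator curves are continuous. [folklore] -/
theorem continuous_oscV : Continuous (oscV ω Q₀ V₀) := by unfold oscV; fun_prop

/-- **The free oscillator moves** (CEHR Prop. 5.21, here quantitative and explicit): at the two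
times `θ/ω`, `2θ/ω` (`0 < θ ≤ 1 < π`) the displacements `f₁, f₂` of `Q̂` from `Q₀` control the
data: `|Q₀| ≤ (|f₂| + 2|f₁|)/(2(1 - cos θ))` and `|V₀/ω| ≤ (|f₁| + |Q₀|(1 - cos θ))/sin θ`
(from `f₂ - 2cos θ f₁ = -2Q₀(1 - cos θ)` and `f₁ = Q₀(cos θ - 1) + (V₀/ω) sin θ`).
[cite: CuneoEckmannHairerReyBellet2018, Prop 5.21] -/
theorem osc_data_le {ω : ℝ} (hω : 0 < ω) {θ : ℝ} (hθ0 : 0 < θ) (hθ1 : θ ≤ 1) (Q₀ V₀ : ℝ) :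
    |Q₀| ≤ (|oscQ ω Q₀ V₀ (2 * θ / ω) - Q₀| + 2 * |oscQ ω Q₀ V₀ (θ / ω) - Q₀|) / (2 * (1 - Real.cos θ)) ∧
    |V₀ / ω| ≤ (|oscQ ω Q₀ V₀ (θ / ω) - Q₀| + |Q₀| * (1 - Real.cos θ)) / Real.sin θ := by
  have hπ : θ < Real.pi := by linarith [Real.two_le_pi]
  have hsin : 0 < Real.sin θ := Real.sin_pos_of_pos_of_lt_pi hθ0 hπ
  have hcos : Real.cos θ < 1 := by
    have hne : Real.cos θ ≠ 1 := by
      rw [Ne, Real.cos_eq_one_iff_of_lt_of_lt (by linarith [Real.pi_pos]) (by linarith [Real.two_le_pi])]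
      exact hθ0.ne'
    exact lt_of_le_of_ne (Real.cos_le_one θ) hne
  have h1c : 0 < 1 - Real.cos θ := by linarith
  set f₁ := oscQ ω Q₀ V₀ (θ / ω) - Q₀ with hf₁
  set f₂ := oscQ ω Q₀ V₀ (2 * θ / ω) - Q₀ with hf₂
  have e1 : f₁ = Q₀ * (Real.cos θ - 1) + V₀ / ω * Real.sin θ := by
    rw [hf₁, oscQ, mul_div_cancel₀ _ hω.ne']; ring
  have e2 : f₂ = Q₀ * (Real.cos (2 * θ) - 1) + V₀ / ω * Real.sin (2 * θ) := by
    rw [hf₂, oscQ, mul_div_cancel₀ _ hω.ne']; ring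
  have key : f₂ - 2 * Real.cos θ * f₁ = -2 * Q₀ * (1 - Real.cos θ) := by
    rw [e1, e2, Real.cos_two_mul, Real.sin_two_mul]; ring
  constructor
  · rw [le_div_iff₀ (by positivity)]
    have h1 : |f₂ - 2 * Real.cos θ * f₁| ≤ |f₂| + 2 * |f₁| := by
      calc |f₂ - 2 * Real.cos θ * f₁| ≤ |f₂| + |2 * Real.cos θ * f₁| := abs_sub _ _
        _ = |f₂| + 2 * |Real.cos θ| * |f₁| := by rw [abs_mul, abs_mul, abs_two]
        _ ≤ |f₂| + 2 * 1 * |f₁| := by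
            gcongr
            exact Real.abs_cos_le_one θ
        _ = |f₂| + 2 * |f₁| := by ring
    have h2 : |f₂ - 2 * Real.cos θ * f₁| = 2 * |Q₀| * (1 - Real.cos θ) := by
      rw [key, abs_mul, abs_mul, abs_of_pos h1c]
      simp
    nlinarith [abs_nonneg Q₀]
  · rw [le_div_iff₀ hsin]
    have h3 : V₀ / ω * Real.sin θ = f₁ - Q₀ * (Real.cos θ - 1) := by rw [e1]; ring
    calc |V₀ / ω| * Real.sin θ = |V₀ / ω * Real.sin θ| := by rw [abs_mul, abs_of_pos hsin]
      _ = |f₁ - Q₀ * (Real.cos θ - 1)| := by rw [h3]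
      _ ≤ |f₁| + |Q₀ * (Real.cos θ - 1)| := abs_sub _ _
      _ = |f₁| + |Q₀| * (1 - Real.cos θ) := by
          rw [abs_mul, show Real.cos θ - 1 = -(1 - Real.cos θ) by ring, abs_neg, abs_of_pos h1c]

end Oscillator

/-! ### Three lemmas: the centre-of-mass energy at time `0`, the linear energy estimate, a weighted Cauchy–Schwarz -/

section Lemmas

variable {ω₂ β γ : ℝ}

/-- The mean deviates from the head by at most `N · D` under the telescoping hypothesis:
`|Q̄ - q_0| ≤ N D`, `Q̄ = (1/N)∑ q_i`. [folklore] -/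
theorem abs_mean_sub_head_le {q : Fin N → ℝ} {D : ℝ} (hN : 0 < N) (hD : 0 ≤ D)
    (hd : ∀ i : Fin N, ∀ h : i.val + 1 < N, |q ⟨i.val + 1, h⟩ - q i| ≤ D) :
    |(∑ i, q i) / N - q ⟨0, hN⟩| ≤ N * D := by
  have hN' : (0 : ℝ) < N := by exact_mod_cast hN
  have h1 : (∑ i, q i) / N - q ⟨0, hN⟩ = (∑ i, (q i - q ⟨0, hN⟩)) / N := by
    rw [Finset.sum_sub_distrib, Finset.sum_const, Finset.card_univ, Fintype.card_fin, nsmul_eq_mul]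
    field_simp
  rw [h1, abs_div, abs_of_pos hN', div_le_iff₀ hN']
  calc |∑ i, (q i - q ⟨0, hN⟩)| ≤ ∑ i, |q i - q ⟨0, hN⟩| := Finset.abs_sum_le_sum_abs _ _
    _ ≤ ∑ i : Fin N, (N : ℝ) * D := Finset.sum_le_sum fun i _ =>
        (abs_sub_head_le hN hd i).trans (mul_le_mul_of_nonneg_right (by exact_mod_cast i.isLt.le) hD)
    _ = N * D * N := by simp; ring

/-- The rescaled energy minus the limit energy is the (rescaled) harmonic part:
`H̃_ε - Ĥ = ε (∑ ω₂q²/2 + ∑_{bonds} δq²/2)`. [cite: CuneoEckmannHairerReyBellet2018, Lemma 5.13] -/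
theorem scaledChain_hamiltonian_sub_limit (ω₂ lam β ε : ℝ) (N : ℕ) (x : PhaseSpace N) :
    (scaledChain ω₂ lam β ε).hamiltonian N x - (limitChain lam β).hamiltonian N x =
      ε * ((∑ i, ω₂ * x.1 i ^ 2 / 2) + ∑ i : Fin N, ∑ j : Fin N,
        if j.val = i.val + 1 then (x.1 j - x.1 i) ^ 2 / 2 else 0) := by
  unfold OscillatorChain.hamiltonian
  simp only [scaledChain, limitChain]
  rw [mul_add, Finset.mul_sum, Finset.mul_sum]
  have h1 : ∀ i : Fin N, ∀ j : Fin N, (if j.val = i.val + 1 then ε * (x.1 j - x.1 i) ^ 2 / 2 + β * (x.1 j - x.1 i) ^ 4 / 4 else 0) -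
      (if j.val = i.val + 1 then β * (x.1 j - x.1 i) ^ 4 / 4 else 0) =
      ε * (if j.val = i.val + 1 then (x.1 j - x.1 i) ^ 2 / 2 else 0) := by
    intro i j; split_ifs <;> ring
  have h2 : ∀ i : Fin N, ε * ∑ j : Fin N, (if j.val = i.val + 1 then (x.1 j - x.1 i) ^ 2 / 2 else 0) =
      ∑ j : Fin N, ((if j.val = i.val + 1 then ε * (x.1 j - x.1 i) ^ 2 / 2 + β * (x.1 j - x.1 i) ^ 4 / 4 else 0) -
        (if j.val = i.val + 1 then β * (x.1 j - x.1 i) ^ 4 / 4 else 0)) := by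
    intro i; rw [Finset.mul_sum]; exact Finset.sum_congr rfl fun j _ => (h1 i j).symm
  simp_rw [h2, Finset.sum_sub_distrib]
  have h3 : ∀ i : Fin N, ε * (ω₂ * x.1 i ^ 2 / 2) = (x.2 i ^ 2 / 2 + (ε * ω₂ * x.1 i ^ 2 / 2 + lam * x.1 i ^ 4 / 4)) -
      (x.2 i ^ 2 / 2 + lam * x.1 i ^ 4 / 4) := by intro i; ring
  simp_rw [h3, Finset.sum_sub_distrib]
  ring

/-- A single inner bond sum has at most one term. [folklore] -/
theorem sum_ite_succ_le {g : Fin N → Fin N → ℝ} {B : ℝ} (hB : 0 ≤ B) (i : Fin N)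
    (hg : ∀ j : Fin N, j.val = i.val + 1 → g i j ≤ B) :
    ∑ j : Fin N, (if j.val = i.val + 1 then g i j else 0) ≤ B := by
  by_cases h : i.val + 1 < N
  · rw [Finset.sum_eq_single_of_mem (⟨i.val + 1, h⟩ : Fin N) (Finset.mem_univ _)]
    · rw [if_pos rfl]; exact hg _ rfl
    · intro j _ hj
      rw [if_neg]
      intro hji; apply hj; ext; exact hji
  · have : ∀ j : Fin N, (if j.val = i.val + 1 then g i j else 0) = 0 := fun j => by
      rw [if_neg]; intro hji; have := j.isLt; omega
    simp [this, hB]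

/-- **The centre of mass is far out in the pinning regime** (CEHR §5.2, the role of
`Ĥ(P̃₀, Q̃₀) ∈ [1/4, 2]` after (5.18)): for the chain with harmonic pinning (`lam = 0`), if
`K⁴ ≤ H(x) ≤ 2K⁴` while the rescaled limit energy `Ĥ(rescale K x) < 1/2` (kinetic plus quartic bond
energy below half), then for `K` large the harmonic pinning energy exceeds `K⁴/4` and the centre
of mass carries `N ω₂ Q̄₀²/2 ≥ K⁴/8`. [cite: CuneoEckmannHairerReyBellet2018, §5.2] -/
theorem pinnedChain_cm_potential_lower (hω : 0 < ω₂) (hβ : 0 < β) (hN : 0 < N) {K : ℝ} (hK : 1 ≤ K)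
    (hK₂ : 4 * N * (1 / 4 + 2 / β) ≤ K ^ 2) (hK₃ : 16 * ω₂ * N ^ 3 * (max 1 (8 / β)) ^ 2 ≤ K ^ 2)
    {x : PhaseSpace N} (hx1 : K ^ 4 ≤ (pinnedChain ω₂ 0 β γ).hamiltonian N x)
    (hx2 : (pinnedChain ω₂ 0 β γ).hamiltonian N x ≤ 2 * K ^ 4)
    (hreg : (limitChain 0 β).hamiltonian N (rescale K x) < 1 / 2) :
    K ^ 4 / 8 ≤ N * ω₂ * ((∑ i, x.1 i) / N) ^ 2 / 2 := by
  have hK0 : 0 < K := by linarith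
  have hN' : (0 : ℝ) < N := by exact_mod_cast hN
  set Cd₀ : ℝ := max 1 (8 / β) with hCd₀
  -- the harmonic part of the energy is more than `K⁴/2`
  have hscale := pinnedChain_hamiltonian_eq_scaled ω₂ 0 β γ hK0.ne' N x
  have hdiff := scaledChain_hamiltonian_sub_limit ω₂ 0 β (K ^ 2)⁻¹ N (rescale K x)
  have hharm : K ^ 4 / 2 < (∑ i, ω₂ * x.1 i ^ 2 / 2) + ∑ i : Fin N, ∑ j : Fin N,
      (if j.val = i.val + 1 then (x.1 j - x.1 i) ^ 2 / 2 else 0) := by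
    have e1 : K ^ 4 * ((K ^ 2)⁻¹ * ((∑ i, ω₂ * (rescale K x).1 i ^ 2 / 2) + ∑ i : Fin N, ∑ j : Fin N,
        (if j.val = i.val + 1 then ((rescale K x).1 j - (rescale K x).1 i) ^ 2 / 2 else 0))) =
        (∑ i, ω₂ * x.1 i ^ 2 / 2) + ∑ i : Fin N, ∑ j : Fin N,
          (if j.val = i.val + 1 then (x.1 j - x.1 i) ^ 2 / 2 else 0) := by
      rw [← mul_assoc, mul_add, Finset.mul_sum, Finset.mul_sum]
      congr 1
      · refine Finset.sum_congr rfl fun i _ => ?_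
        simp only [rescale_fst]; field_simp
      · refine Finset.sum_congr rfl fun i _ => ?_
        rw [Finset.mul_sum]
        refine Finset.sum_congr rfl fun j _ => ?_
        split_ifs
        · simp only [rescale_fst]; field_simp
        · simp
    rw [← e1, ← hdiff, mul_sub, ← hscale]
    have hK4 : 0 < K ^ 4 := by positivity
    nlinarith [mul_lt_mul_of_pos_left hreg hK4]
  -- the bond part is at most `K⁴/4`
  have hbond : ∑ i : Fin N, ∑ j : Fin N, (if j.val = i.val + 1 then (x.1 j - x.1 i) ^ 2 / 2 else 0) ≤ K ^ 4 / 4 := by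
    have hterm : ∀ i j : Fin N, j.val = i.val + 1 → (x.1 j - x.1 i) ^ 2 / 2 ≤ (1 / 4 + 2 / β) * K ^ 2 := by
      intro i j hj
      have hb := pinnedChain_bond_le_hamiltonian hω.le le_rfl hβ.le γ N x hj
      have h4 : (x.1 j - x.1 i) ^ 4 ≤ 8 * K ^ 4 / β := by
        rw [le_div_iff₀ hβ]; nlinarith [sq_nonneg (x.1 j - x.1 i)]
      -- `r² ≤ K²/2 + r⁴/(2K²)`
      have hamgm : (x.1 j - x.1 i) ^ 2 ≤ K ^ 2 / 2 + (x.1 j - x.1 i) ^ 4 / (2 * K ^ 2) := by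
        rw [div_add_div _ _ (two_ne_zero) (by positivity), le_div_iff₀ (by positivity)]
        nlinarith [sq_nonneg ((x.1 j - x.1 i) ^ 2 - K ^ 2)]
      have h5 : (x.1 j - x.1 i) ^ 4 / (2 * K ^ 2) ≤ (8 * K ^ 4 / β) / (2 * K ^ 2) :=
        div_le_div_of_nonneg_right h4 (by positivity)
      have h6 : (8 * K ^ 4 / β) / (2 * K ^ 2) = 4 / β * K ^ 2 := by field_simp; ring
      have h7 := hamgm.trans (add_le_add_right (h5.trans_eq h6) (K ^ 2 / 2))
      have h8 : (1 / 4 + 2 / β) * K ^ 2 = (K ^ 2 / 2 + 4 / β * K ^ 2) / 2 := by ring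
      rw [h8]
      linarith
    calc ∑ i : Fin N, ∑ j : Fin N, (if j.val = i.val + 1 then (x.1 j - x.1 i) ^ 2 / 2 else 0)
        ≤ ∑ _i : Fin N, (1 / 4 + 2 / β) * K ^ 2 :=
          Finset.sum_le_sum fun i _ => sum_ite_succ_le (g := fun i j => (x.1 j - x.1 i) ^ 2 / 2)
            (by positivity) i (hterm i)
      _ = N * ((1 / 4 + 2 / β) * K ^ 2) := by simp
      _ ≤ K ^ 4 / 4 := by nlinarith [hK₂]
  have hpin : K ^ 4 / 4 < ∑ i, ω₂ * x.1 i ^ 2 / 2 := by linarith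
  -- positions relative to the centre of mass: `|q_i - Q̄| ≤ 2 N Cd₀ K`
  have hd : ∀ i : Fin N, ∀ h : i.val + 1 < N, |x.1 ⟨i.val + 1, h⟩ - x.1 i| ≤ Cd₀ * K := by
    intro i h
    have hb := pinnedChain_bond_le_hamiltonian hω.le le_rfl hβ.le γ N x (i := i) (j := ⟨i.val + 1, h⟩) rfl
    have h4 : ((x.1 ⟨i.val + 1, h⟩ - x.1 i) / K) ^ 4 ≤ 8 / β := by
      rw [div_pow, div_le_div_iff₀ (by positivity) hβ]
      nlinarith [sq_nonneg (x.1 ⟨i.val + 1, h⟩ - x.1 i)]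
    have := abs_le_max_one_of_pow_four_le h4
    rw [abs_div, abs_of_pos hK0, div_le_iff₀ hK0] at this
    exact this
  set Q : ℝ := (∑ i, x.1 i) / N with hQ
  have hdev : ∀ i, |x.1 i - Q| ≤ 2 * N * Cd₀ * K := by
    intro i
    have h1 := abs_sub_head_le hN hd i
    have h2 := abs_mean_sub_head_le hN (by positivity) hd
    calc |x.1 i - Q| = |(x.1 i - x.1 ⟨0, hN⟩) - (Q - x.1 ⟨0, hN⟩)| := by ring_nf
      _ ≤ |x.1 i - x.1 ⟨0, hN⟩| + |Q - x.1 ⟨0, hN⟩| := abs_sub _ _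
      _ ≤ i.val * (Cd₀ * K) + N * (Cd₀ * K) := add_le_add h1 h2
      _ ≤ N * (Cd₀ * K) + N * (Cd₀ * K) :=
          add_le_add (mul_le_mul_of_nonneg_right (by exact_mod_cast i.isLt.le) (by positivity)) le_rfl
      _ = 2 * N * Cd₀ * K := by ring
  -- parallel axis: `∑ q_i² = N Q̄² + ∑ (q_i - Q̄)²`
  have hpar : ∑ i, x.1 i ^ 2 = N * Q ^ 2 + ∑ i, (x.1 i - Q) ^ 2 := by
    have hsum : ∑ i, x.1 i = N * Q := by rw [hQ]; field_simp
    have : ∑ i, (x.1 i - Q) ^ 2 = ∑ i, x.1 i ^ 2 - 2 * Q * ∑ i, x.1 i + N * Q ^ 2 := by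
      rw [Finset.mul_sum, ← Finset.sum_sub_distrib]
      rw [show (N : ℝ) * Q ^ 2 = ∑ _i : Fin N, Q ^ 2 by simp]
      rw [← Finset.sum_add_distrib]
      exact Finset.sum_congr rfl fun i _ => by ring
    rw [this, hsum]; ring
  have hdev2 : ∑ i, (x.1 i - Q) ^ 2 ≤ N * (2 * N * Cd₀ * K) ^ 2 := by
    calc ∑ i, (x.1 i - Q) ^ 2 ≤ ∑ _i : Fin N, (2 * N * Cd₀ * K) ^ 2 := Finset.sum_le_sum fun i _ => by
          rw [← sq_abs]; exact pow_le_pow_left₀ (abs_nonneg _) (hdev i) 2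
      _ = N * (2 * N * Cd₀ * K) ^ 2 := by simp
  have hsumq : ∑ i, ω₂ * x.1 i ^ 2 / 2 = ω₂ / 2 * ∑ i, x.1 i ^ 2 := by
    rw [Finset.mul_sum]; exact Finset.sum_congr rfl fun i _ => by ring
  rw [hsumq, hpar] at hpin
  -- `ω₂/2 · N (2NCd₀K)² ≤ K⁴/8` by `hK₃`
  have hsmall : ω₂ / 2 * (N * (2 * N * Cd₀ * K) ^ 2) ≤ K ^ 4 / 8 := by
    have : ω₂ / 2 * (N * (2 * N * Cd₀ * K) ^ 2) = (16 * ω₂ * N ^ 3 * Cd₀ ^ 2) * K ^ 2 / 8 := by ring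
    rw [this]
    have hK2 : 0 ≤ K ^ 2 := sq_nonneg K
    nlinarith [mul_le_mul_of_nonneg_right hK₃ hK2]
  nlinarith [mul_le_mul_of_nonneg_left hdev2 (by positivity : 0 ≤ ω₂ / 2)]

/-- **The linear energy estimate** for the perturbed oscillator `D₁' = D₂ + a`, `D₂' = -ω₂D₁ + b`,
`D(0) = 0`: `ω₂D₁(t)² + D₂(t)² ≤ e^{T} ∫₀ᵀ (ω₂a² + b²)` on `[0, T]` (energy method:
`E' = 2ω₂D₁a + 2D₂b ≤ E + ω₂a² + b²`, so `e^{-t}E - ∫₀ᵗ(ω₂a² + b²)` is nonincreasing).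
[cite: CuneoEckmannHairerReyBellet2018, Lemma 5.8] -/
theorem linear_energy_estimate (hω : 0 ≤ ω₂) {T : ℝ} (hT : 0 ≤ T) {D₁ D₂ a b : ℝ → ℝ}
    (ha : Continuous a) (hb : Continuous b) (hD₁c : Continuous D₁) (hD₂c : Continuous D₂)
    (hD₁ : ∀ t ∈ Icc 0 T, HasDerivAt D₁ (D₂ t + a t) t) (hD₂ : ∀ t ∈ Icc 0 T, HasDerivAt D₂ (-ω₂ * D₁ t + b t) t)
    (h0₁ : D₁ 0 = 0) (h0₂ : D₂ 0 = 0) :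
    ∀ t ∈ Icc 0 T, ω₂ * D₁ t ^ 2 + D₂ t ^ 2 ≤ Real.exp T * ∫ s in (0 : ℝ)..T, (ω₂ * a s ^ 2 + b s ^ 2) := by
  intro t ht
  set φ : ℝ → ℝ := fun s => ω₂ * a s ^ 2 + b s ^ 2 with hφ
  have hφc : Continuous φ := by simp only [hφ]; fun_prop
  have hφ0 : ∀ s, 0 ≤ φ s := fun s => by simp only [hφ]; positivity
  set E : ℝ → ℝ := fun s => ω₂ * D₁ s ^ 2 + D₂ s ^ 2 with hE
  set h : ℝ → ℝ := fun s => Real.exp (-s) * E s - ∫ r in (0 : ℝ)..s, φ r with hh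
  -- derivative of `h` on `[0, T]` is nonpositive
  have hderiv : ∀ s ∈ Icc 0 T, HasDerivAt h
      (-Real.exp (-s) * E s + Real.exp (-s) * (2 * ω₂ * D₁ s * a s + 2 * D₂ s * b s) - φ s) s := by
    intro s hs
    have hE' : HasDerivAt E (2 * ω₂ * D₁ s * a s + 2 * D₂ s * b s) s := by
      have h1 := ((hD₁ s hs).pow 2).const_mul ω₂
      have h2 := (hD₂ s hs).pow 2
      have h3 := h1.add h2
      refine h3.congr_deriv ?_
      simp only [Nat.cast_ofNat]
      ring
    have hexp : HasDerivAt (fun s => Real.exp (-s)) (-Real.exp (-s)) s := by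
      simpa using (hasDerivAt_neg s).exp
    have hint : HasDerivAt (fun s => ∫ r in (0 : ℝ)..s, φ r) (φ s) s :=
      (hφc.integral_hasStrictDerivAt 0 s).hasDerivAt
    have := (hexp.mul hE').sub hint
    refine this.congr_deriv ?_
    ring
  have hnonpos : ∀ s ∈ Icc 0 T,
      -Real.exp (-s) * E s + Real.exp (-s) * (2 * ω₂ * D₁ s * a s + 2 * D₂ s * b s) - φ s ≤ 0 := by
    intro s hs
    have he1 : Real.exp (-s) ≤ 1 := by rw [Real.exp_le_one_iff]; linarith [hs.1]
    have he0 : 0 < Real.exp (-s) := Real.exp_pos _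
    have hcs : 2 * ω₂ * D₁ s * a s + 2 * D₂ s * b s ≤ E s + φ s := by
      simp only [hE, hφ]
      nlinarith [sq_nonneg (D₁ s - a s), sq_nonneg (D₂ s - b s), mul_nonneg hω (sq_nonneg (D₁ s - a s))]
    have : Real.exp (-s) * (2 * ω₂ * D₁ s * a s + 2 * D₂ s * b s) ≤ Real.exp (-s) * (E s + φ s) :=
      mul_le_mul_of_nonneg_left hcs he0.le
    nlinarith [hφ0 s, mul_le_mul_of_nonneg_right he1 (hφ0 s)]
  have hcont : ContinuousOn h (Icc 0 T) := by
    have h1 : Continuous fun s => ∫ r in (0 : ℝ)..s, φ r :=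
      continuous_iff_continuousAt.2 fun s => (hφc.integral_hasStrictDerivAt 0 s).hasDerivAt.continuousAt
    have hEc : Continuous E := by simp only [hE]; fun_prop
    have : Continuous h := ((Real.continuous_exp.comp continuous_neg).mul hEc).sub h1
    exact this.continuousOn
  have hanti : AntitoneOn h (Icc 0 T) :=
    antitoneOn_of_hasDerivWithinAt_nonpos (convex_Icc 0 T) hcont
      (fun s hs => by
        rw [interior_Icc] at hs
        exact ((hderiv s ⟨hs.1.le, hs.2.le⟩).hasDerivWithinAt))
      (fun s hs => by
        rw [interior_Icc] at hs
        exact hnonpos s ⟨hs.1.le, hs.2.le⟩)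
  have hh0 : h 0 = 0 := by simp [hh, hE, h0₁, h0₂]
  have hht : h t ≤ 0 := by
    have := hanti ⟨le_rfl, hT⟩ ht ht.1
    rwa [hh0] at this
  -- unpack
  have hEt : E t ≤ Real.exp t * ∫ r in (0 : ℝ)..t, φ r := by
    have h1 : Real.exp (-t) * E t ≤ ∫ r in (0 : ℝ)..t, φ r := by
      have := hht; simp only [hh] at this; linarith
    have h2 := mul_le_mul_of_nonneg_left h1 (Real.exp_pos t).le
    rwa [← mul_assoc, ← Real.exp_add, add_neg_cancel, Real.exp_zero, one_mul] at h2
  have hmono : ∫ r in (0 : ℝ)..t, φ r ≤ ∫ r in (0 : ℝ)..T, φ r :=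
    intervalIntegral.integral_mono_interval le_rfl ht.1 ht.2 (Eventually.of_forall hφ0)
      (hφc.intervalIntegrable _ _)
  have hexpT : Real.exp t ≤ Real.exp T := Real.exp_le_exp.2 ht.2
  have hI0 : 0 ≤ ∫ r in (0 : ℝ)..t, φ r := intervalIntegral.integral_nonneg ht.1 fun r _ => hφ0 r
  calc ω₂ * D₁ t ^ 2 + D₂ t ^ 2 = E t := rfl
    _ ≤ Real.exp t * ∫ r in (0 : ℝ)..t, φ r := hEt
    _ ≤ Real.exp T * ∫ r in (0 : ℝ)..T, φ r :=
        mul_le_mul hexpT hmono hI0 (Real.exp_pos T).le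

/-- Weighted Cauchy–Schwarz with the bath weights: `(∑ w_i a_i)² ≤ 2 ∑ w_i a_i²` (`∑ w_i = 2`).
[folklore] -/
theorem sq_sum_bathWeight_mul_le (hN : 0 < N) (a : Fin N → ℝ) :
    (∑ i, bathWeight N i * a i) ^ 2 ≤ 2 * ∑ i, bathWeight N i * a i ^ 2 := by
  have hw0 : ∀ i, 0 ≤ bathWeight N i := fun i => by unfold bathWeight; split_ifs <;> norm_num
  have h := Finset.sum_mul_sq_le_sq_mul_sq Finset.univ (fun i => Real.sqrt (bathWeight N i))
    (fun i => Real.sqrt (bathWeight N i) * a i)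
  have h1 : ∀ i, Real.sqrt (bathWeight N i) * (Real.sqrt (bathWeight N i) * a i) = bathWeight N i * a i := fun i => by
    rw [← mul_assoc, Real.mul_self_sqrt (hw0 i)]
  have h2 : ∀ i, Real.sqrt (bathWeight N i) ^ 2 = bathWeight N i := fun i => Real.sq_sqrt (hw0 i)
  have h3 : ∀ i, (Real.sqrt (bathWeight N i) * a i) ^ 2 = bathWeight N i * a i ^ 2 := fun i => by
    rw [mul_pow, h2]
  simp only [h1, h2, h3, sum_bathWeight hN] at h
  exact h

end Lemmas

/-! ### Bounds on the window in the original time, and the final arithmetic -/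

section Window

variable {ω₂ lam β γ : ℝ} (hω : 0 < ω₂) (hl : 0 ≤ lam) (hβ : 0 < β) (hγ : 0 ≤ γ) (N : ℕ)
include hω hl hβ hγ

/-- **Bounds along the driven path over a window `[0, T]` of order one** (from the energy ceiling,
`H(x) ≤ 2K⁴`, `‖η‖ ≤ δ₀K`, `δ₀ ≤ 1`, `Aδ₀T ≤ 1`, `K ≥ 1`): smooth momenta `|ȳ_i| ≤ (c₁ + 1/2)K²`,
momenta `|p_i| ≤ (c₁ + 3/2)K²`, bond stretches `|δq| ≤ max(1, 4c₁/β) K`.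
[cite: CuneoEckmannHairerReyBellet2018, Lemma 5.10 and eq. (5.19)] -/
theorem pinnedChain_window_bounds {K : ℝ} (hK : 1 ≤ K) (x : PhaseSpace N)
    (hx : (pinnedChain ω₂ lam β γ).hamiltonian N x ≤ 2 * K ^ 4)
    {η : ℝ → Fin N → ℝ} (hη : Continuous η) {T δ₀ : ℝ} (hδ₁ : δ₀ ≤ 1)
    (hM : ∀ s ∈ Icc 0 T, ‖η s‖ ≤ δ₀ * K) (hAδ : pinnedChainScaleA γ N * δ₀ * T ≤ 1)
    {s : ℝ} (hs : s ∈ Icc 0 T) :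
    (∀ i, |((pinnedChain ω₂ lam β γ).chainFlow N x η s - ((0 : Fin N → ℝ), η s)).2 i| ≤
        (pinnedChainScaleC ω₂ lam β γ N + 1 / 2) * K ^ 2) ∧
    (∀ i, |((pinnedChain ω₂ lam β γ).chainFlow N x η s).2 i| ≤
        (pinnedChainScaleC ω₂ lam β γ N + 3 / 2) * K ^ 2) ∧
    (∀ i : Fin N, ∀ h : i.val + 1 < N,
        |((pinnedChain ω₂ lam β γ).chainFlow N x η s).1 ⟨i.val + 1, h⟩ -
          ((pinnedChain ω₂ lam β γ).chainFlow N x η s).1 i| ≤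
        max 1 (4 * pinnedChainScaleC ω₂ lam β γ N / β) * K) := by
  set P := pinnedChain ω₂ lam β γ with hP
  set c₁ := pinnedChainScaleC ω₂ lam β γ N with hc₁
  set z := P.chainFlow N x η with hz
  have hK0 : 0 < K := by linarith
  have hT : 0 ≤ T := hs.1.trans hs.2
  have hδ0 : 0 ≤ δ₀ := by
    have := (norm_nonneg _).trans (hM 0 ⟨le_rfl, hT⟩)
    nlinarith
  have hAMT : pinnedChainScaleA γ N * (δ₀ * K) * T ≤ K := by
    have : pinnedChainScaleA γ N * (δ₀ * K) * T = (pinnedChainScaleA γ N * δ₀ * T) * K := by ring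
    rw [this]
    have := mul_le_mul_of_nonneg_right hAδ hK0.le
    linarith
  set y := z s - ((0 : Fin N → ℝ), η s) with hy
  have hceil : P.hamiltonian N y ≤ c₁ * K ^ 4 :=
    pinnedChain_hamiltonian_chainFlow_le_ceiling hω hl hβ.le hγ N hK x hx hη hM hAMT s hs
  have hy1 : ∀ j, y.1 j = (z s).1 j := fun j => by simp [hy]
  have hy2 : ∀ j, (z s).2 j = y.2 j + η s j := fun j => by simp [hy]
  have hηi : ∀ j, |η s j| ≤ δ₀ * K := fun j =>
    (show |η s j| ≤ ‖η s‖ by rw [← Real.norm_eq_abs]; exact norm_le_pi_norm (η s) j).trans (hM s hs)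
  have hmom : ∀ i, |y.2 i| ≤ (c₁ + 1 / 2) * K ^ 2 := by
    intro i
    have h1 := pinnedChain_abs_momentum_le_scale hω.le hl hβ.le γ N hK0 y i
    have h2 : P.hamiltonian N y / K ^ 2 ≤ c₁ * K ^ 4 / K ^ 2 := div_le_div_of_nonneg_right hceil (by positivity)
    have h3 : c₁ * K ^ 4 / K ^ 2 = c₁ * K ^ 2 := by rw [div_eq_iff (by positivity)]; ring
    linarith
  refine ⟨hmom, fun i => ?_, fun i h => ?_⟩
  · rw [hy2]
    calc |y.2 i + η s i| ≤ |y.2 i| + |η s i| := abs_add_le _ _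
      _ ≤ (c₁ + 1 / 2) * K ^ 2 + δ₀ * K := add_le_add (hmom i) (hηi i)
      _ ≤ (c₁ + 3 / 2) * K ^ 2 := by nlinarith
  · rw [← hy1, ← hy1]
    have hb := pinnedChain_bond_le_hamiltonian hω.le hl hβ.le γ N y (i := i) (j := ⟨i.val + 1, h⟩) rfl
    have h4 : ((y.1 ⟨i.val + 1, h⟩ - y.1 i) / K) ^ 4 ≤ 4 * c₁ / β := by
      rw [div_pow, div_le_div_iff₀ (by positivity) hβ]
      nlinarith [sq_nonneg (y.1 ⟨i.val + 1, h⟩ - y.1 i)]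
    have := abs_le_max_one_of_pow_four_le h4
    rw [abs_div, abs_of_pos hK0, div_le_iff₀ hK0] at this
    exact this

end Window

/-- The final arithmetic of the pinning regime: with `4κa² ≤ 1/32`, `8κe^Tγξ/(ω₂N²) ≤ 1/32`,
`32(4κb² + 2κe^Tc/ω₂) ≤ K`, `K ≥ 1`, a displacement `0 ≤ Δ ≤ K²a + Kb` and an oscillator-error energy
`Eb ≤ (e^T/ω₂)(cK² + 4γξK⁴/N²)` give `κ(2Δ² + 2Eb) < K⁴/8`. [folklore] -/
theorem pinning_arith {κ a b c ξ γ ω₂ T Δ Eb K Nr : ℝ} (hκ : 0 ≤ κ) (hω : 0 < ω₂)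
    (hK : 1 ≤ K) (hΔ0 : 0 ≤ Δ)
    (h4a : 4 * κ * a ^ 2 ≤ 1 / 32) (hξE : 8 * κ * Real.exp T * γ * ξ / (ω₂ * Nr ^ 2) ≤ 1 / 32)
    (hKc : 32 * (4 * κ * b ^ 2 + 2 * κ * Real.exp T * c / ω₂) ≤ K)
    (hΔ : Δ ≤ K ^ 2 * a + K * b) (hEb : Eb ≤ Real.exp T / ω₂ * (c * K ^ 2 + 4 * γ * ξ * K ^ 4 / Nr ^ 2)) :
    κ * (2 * Δ ^ 2 + 2 * Eb) < K ^ 4 / 8 := by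
  have hK0 : 0 < K := by linarith
  have h1 : Δ ^ 2 ≤ 2 * K ^ 4 * a ^ 2 + 2 * K ^ 2 * b ^ 2 := by
    have h2 : Δ ^ 2 ≤ (K ^ 2 * a + K * b) ^ 2 := pow_le_pow_left₀ hΔ0 hΔ 2
    nlinarith [sq_nonneg (K ^ 2 * a - K * b)]
  have h3 : κ * (2 * Δ ^ 2 + 2 * Eb) ≤
      K ^ 4 * (4 * κ * a ^ 2 + 8 * κ * Real.exp T * γ * ξ / (ω₂ * Nr ^ 2)) +
        K ^ 2 * (4 * κ * b ^ 2 + 2 * κ * Real.exp T * c / ω₂) := by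
    have e : K ^ 4 * (4 * κ * a ^ 2 + 8 * κ * Real.exp T * γ * ξ / (ω₂ * Nr ^ 2)) +
        K ^ 2 * (4 * κ * b ^ 2 + 2 * κ * Real.exp T * c / ω₂) =
        κ * (2 * (2 * K ^ 4 * a ^ 2 + 2 * K ^ 2 * b ^ 2) +
          2 * (Real.exp T / ω₂ * (c * K ^ 2 + 4 * γ * ξ * K ^ 4 / Nr ^ 2))) := by
      field_simp
      ring
    rw [e]
    exact mul_le_mul_of_nonneg_left (by linarith) hκ
  have h4 : K ^ 2 * (4 * κ * b ^ 2 + 2 * κ * Real.exp T * c / ω₂) ≤ K ^ 4 / 32 := by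
    have h5 : K ^ 2 * (4 * κ * b ^ 2 + 2 * κ * Real.exp T * c / ω₂) ≤ K ^ 2 * (K / 32) :=
      mul_le_mul_of_nonneg_left (by linarith) (by positivity)
    have h6 : K ^ 2 * (K / 32) ≤ K ^ 4 / 32 := by
      have : K ^ 3 ≤ K ^ 4 := pow_le_pow_right₀ hK (by norm_num)
      nlinarith
    linarith
  have h7 : K ^ 4 * (4 * κ * a ^ 2 + 8 * κ * Real.exp T * γ * ξ / (ω₂ * Nr ^ 2)) ≤ K ^ 4 * (1 / 32 + 1 / 32) :=
    mul_le_mul_of_nonneg_left (by linarith) (by positivity)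
  have hK4 : 0 < K ^ 4 := by positivity
  linarith

/-- Smallness of the displacement coefficient: with `ν = 1/(1 + 128κT²)` and
`ξ ≤ min(1, ν²γ²/(128κ+1))`, `4κ(ξ/(2νγ) + Tν/2)² ≤ 1/32`. [folklore] -/
theorem pinning_small_a {κ T γ ν ξ : ℝ} (hκ0 : 0 < κ) (hγ : 0 < γ) (hT : 0 < T)
    (hν : ν = 1 / (1 + 128 * κ * T ^ 2)) (hξ0 : 0 ≤ ξ) (hξ1 : ξ ≤ 1)
    (hξ2 : ξ ≤ ν ^ 2 * γ ^ 2 / (128 * κ + 1)) :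
    4 * κ * (ξ / (2 * ν * γ) + T * ν / 2) ^ 2 ≤ 1 / 32 := by
  have hν0 : 0 < ν := by rw [hν]; positivity
  have hν1 : ν ≤ 1 := by
    rw [hν, div_le_one (by positivity)]; nlinarith [hκ0.le, sq_nonneg T]
  have hsq : (ξ / (2 * ν * γ) + T * ν / 2) ^ 2 ≤ ξ ^ 2 / (2 * ν ^ 2 * γ ^ 2) + T ^ 2 * ν ^ 2 / 2 := by
    have e : (ξ / (2 * ν * γ) + T * ν / 2) ^ 2 = ξ ^ 2 / (2 * ν ^ 2 * γ ^ 2) + T ^ 2 * ν ^ 2 / 2 -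
        (ξ / (2 * ν * γ) - T * ν / 2) ^ 2 := by
      field_simp
      ring
    rw [e]
    linarith [sq_nonneg (ξ / (2 * ν * γ) - T * ν / 2)]
  have h1 : 2 * κ * (T ^ 2 * ν ^ 2) ≤ 1 / 64 := by
    have hνν : ν ^ 2 ≤ ν := by nlinarith
    have h2 : 2 * κ * (T ^ 2 * ν) ≤ 1 / 64 := by
      rw [hν, show 2 * κ * (T ^ 2 * (1 / (1 + 128 * κ * T ^ 2))) = 2 * κ * T ^ 2 / (1 + 128 * κ * T ^ 2) by ring,
        div_le_iff₀ (by positivity)]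
      nlinarith [hκ0.le, sq_nonneg T]
    nlinarith [mul_le_mul_of_nonneg_left hνν (by positivity : 0 ≤ 2 * κ * T ^ 2)]
  have h3 : 4 * κ * (ξ ^ 2 / (2 * ν ^ 2 * γ ^ 2)) ≤ 1 / 64 := by
    have hξsq : ξ ^ 2 ≤ ν ^ 2 * γ ^ 2 / (128 * κ + 1) := by
      calc ξ ^ 2 = ξ * ξ := sq ξ
        _ ≤ 1 * (ν ^ 2 * γ ^ 2 / (128 * κ + 1)) := mul_le_mul hξ1 hξ2 hξ0 zero_le_one
        _ = _ := one_mul _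
    have h5 : ξ ^ 2 / (2 * ν ^ 2 * γ ^ 2) ≤ (ν ^ 2 * γ ^ 2 / (128 * κ + 1)) / (2 * ν ^ 2 * γ ^ 2) :=
      div_le_div_of_nonneg_right hξsq (by positivity)
    have h6 : (ν ^ 2 * γ ^ 2 / (128 * κ + 1)) / (2 * ν ^ 2 * γ ^ 2) = 1 / (2 * (128 * κ + 1)) := by
      field_simp
    rw [h6] at h5
    have h7 : 4 * κ * (1 / (2 * (128 * κ + 1))) ≤ 1 / 64 := by
      rw [show 4 * κ * (1 / (2 * (128 * κ + 1))) = 4 * κ / (2 * (128 * κ + 1)) by ring,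
        div_le_iff₀ (by positivity)]
      nlinarith
    nlinarith [mul_le_mul_of_nonneg_left h5 (by positivity : 0 ≤ 4 * κ)]
  nlinarith [mul_le_mul_of_nonneg_left hsq (by positivity : 0 ≤ 4 * κ)]

/-- Smallness of the energy coefficient: `ξ ≤ N²ω₂/(256κe^Tγ + 1)` gives
`8κe^Tγξ/(ω₂N²) ≤ 1/32`. [folklore] -/
theorem pinning_small_ξ {κ T γ ω₂ Nr ξ : ℝ} (hκ0 : 0 < κ) (hγ : 0 < γ) (hω : 0 < ω₂) (hN : 0 < Nr)
    (hξ3 : ξ ≤ Nr ^ 2 * ω₂ / (256 * κ * Real.exp T * γ + 1)) :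
    8 * κ * Real.exp T * γ * ξ / (ω₂ * Nr ^ 2) ≤ 1 / 32 := by
  have h1 : 8 * κ * Real.exp T * γ * ξ / (ω₂ * Nr ^ 2) ≤
      8 * κ * Real.exp T * γ * (Nr ^ 2 * ω₂ / (256 * κ * Real.exp T * γ + 1)) / (ω₂ * Nr ^ 2) := by
    gcongr
  have h2 : 8 * κ * Real.exp T * γ * (Nr ^ 2 * ω₂ / (256 * κ * Real.exp T * γ + 1)) / (ω₂ * Nr ^ 2) =
      8 * κ * Real.exp T * γ / (256 * κ * Real.exp T * γ + 1) := by
    field_simp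
  rw [h2] at h1
  refine h1.trans ?_
  rw [div_le_iff₀ (by positivity)]
  nlinarith [mul_pos (mul_pos hκ0 (Real.exp_pos T)) hγ]

/-- `(p + 2q)² ≤ 3p² + 6q²`. [folklore] -/
theorem sq_add_two_mul_le (p q : ℝ) : (p + 2 * q) ^ 2 ≤ 3 * p ^ 2 + 6 * q ^ 2 := by
  nlinarith [sq_nonneg (p - q)]

/-! ### The dissipation bound in the pinning regime (CEHR Prop. 5.3, case of §5.2) -/

section Main

variable {ω₂ β γ : ℝ}

set_option maxHeartbeats 6000000 in
/-- **High-energy dissipation over a window of order one, pinning regime** (CEHR Prop. 5.3 with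
§5.2, pathwise; `lam = 0`, i.e. `ℓ_p = 2 < ℓ_i = 4`): fix a window `T > 0` and a noise size
`δ₀ ∈ (0,1]` with `Aδ₀T ≤ 1`. There are `K₀ ≥ 1` and `ε > 0` such that for every scale `K ≥ K₀`,
every initial condition with `K⁴ ≤ H(x) ≤ 2K⁴` in the pinning-dominated regime
`Ĥ(rescale K x) < 1/2`, and every continuous noise path with `‖η‖ ≤ δ₀K` on `[0, T]`, the
dissipation of the smooth part satisfies `γ∫₀ᵀ ∑ᵢ wᵢ ȳᵢ² ds ≥ εK⁴`. Proof (the chain of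
Lemma 5.22): the centre of mass `Q̄` obeys the forced oscillator `Q̄' = V̄ + η̄`,
`V̄' = -ω₂Q̄ - (γ/N)∑wᵢpᵢ` (the interaction forces cancel); if the dissipation were `≤ ξK⁴` then the
bath momenta are small in `L²`, so (energy estimate for the linear system) `Q̄` stays within
`O(√ξ K² + K)` of the free oscillator, and `q₀`, hence `Q̄` (bond stretches are `O(K)`), moves by
`O(√ξK² + K)`; but the free oscillator started at `|Q̄₀| ≍ K²` (Prop. 5.21, `pinnedChain_cm_potential_lower`
and `osc_data_le`) moves by `≍ K²` — a contradiction for `ξ` small and `K` large.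
[cite: CuneoEckmannHairerReyBellet2018, Prop 5.3, §5.2 Lemma 5.22 and Prop 5.21] -/
theorem pinnedChain_dissipation_ge_pinning (hω : 0 < ω₂) (hβ : 0 < β) (hγ : 0 < γ) (hN : 0 < N)
    {T δ₀ : ℝ} (hT : 0 < T) (hδ₀ : 0 < δ₀) (hδ₁ : δ₀ ≤ 1) (hAδ : pinnedChainScaleA γ N * δ₀ * T ≤ 1) :
    ∃ K₀ ε : ℝ, 1 ≤ K₀ ∧ 0 < ε ∧ ∀ K : ℝ, K₀ ≤ K → ∀ x : PhaseSpace N,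
      K ^ 4 ≤ (pinnedChain ω₂ 0 β γ).hamiltonian N x →
      (pinnedChain ω₂ 0 β γ).hamiltonian N x ≤ 2 * K ^ 4 →
      (limitChain 0 β).hamiltonian N (rescale K x) < 1 / 2 →
      ∀ η : ℝ → Fin N → ℝ, Continuous η → (∀ s ∈ Icc 0 T, ‖η s‖ ≤ δ₀ * K) →
        ε * K ^ 4 ≤ γ * ∫ s in (0 : ℝ)..T, ∑ i, bathWeight N i *
          ((pinnedChain ω₂ 0 β γ).chainFlow N x η s - ((0 : Fin N → ℝ), η s)).2 i ^ 2 := by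
  -- constants
  have hN' : (0 : ℝ) < N := by exact_mod_cast hN
  set c₁ := pinnedChainScaleC ω₂ 0 β γ N with hc₁
  have hc6 : 6 ≤ c₁ := by
    rw [hc₁]; unfold pinnedChainScaleC
    have hA : 0 < pinnedChainScaleA γ N := lt_of_lt_of_le one_pos (one_le_pinnedChainScaleA hγ.le N)
    have hB := pinnedChainScaleB_nonneg hω.le le_rfl hβ.le hγ.le N
    have : 0 ≤ pinnedChainScaleB ω₂ 0 β γ N / pinnedChainScaleA γ N := by positivity
    linarith
  set Cd : ℝ := max 1 (4 * c₁ / β) with hCd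
  have hCd0 : 0 ≤ Cd := zero_le_one.trans (le_max_left _ _)
  set Cd₀ : ℝ := max 1 (8 / β) with hCd₀
  set ω : ℝ := Real.sqrt ω₂ with hωdef
  have hωpos : 0 < ω := Real.sqrt_pos.2 hω
  have hω2 : ω ^ 2 = ω₂ := Real.sq_sqrt hω.le
  set θ : ℝ := min (ω * T / 2) 1 with hθ
  have hθ0 : 0 < θ := lt_min (by positivity) one_pos
  have hθ1 : θ ≤ 1 := min_le_right _ _
  have hθT : 2 * θ / ω ≤ T := by
    rw [div_le_iff₀ hωpos]
    have := min_le_left (ω * T / 2) 1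
    linarith
  set cθ : ℝ := 1 - Real.cos θ with hcθ
  have hcθ0 : 0 < cθ := by
    have hne : Real.cos θ ≠ 1 := by
      rw [Ne, Real.cos_eq_one_iff_of_lt_of_lt (by linarith [Real.pi_pos]) (by linarith [Real.two_le_pi])]
      exact hθ0.ne'
    have := lt_of_le_of_ne (Real.cos_le_one θ) hne
    rw [hcθ]; linarith
  set κ : ℝ := 9 * N * ω₂ / (8 * cθ ^ 2) with hκ
  have hκ0 : 0 < κ := by positivity
  set ν : ℝ := 1 / (1 + 128 * κ * T ^ 2) with hν
  have hν0 : 0 < ν := by positivity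
  have hν1 : ν ≤ 1 := by
    rw [hν, div_le_one (by positivity)]; nlinarith [hκ0.le, sq_nonneg T]
  set ξ : ℝ := min 1 (min (ν ^ 2 * γ ^ 2 / (128 * κ + 1)) (N ^ 2 * ω₂ / (256 * κ * Real.exp T * γ + 1))) with hξ
  have hξ0 : 0 < ξ := lt_min one_pos (lt_min (by positivity) (by positivity))
  have hξ1 : ξ ≤ 1 := min_le_left _ _
  have hξ2 : ξ ≤ ν ^ 2 * γ ^ 2 / (128 * κ + 1) := (min_le_right _ _).trans (min_le_left _ _)
  have hξ3 : ξ ≤ N ^ 2 * ω₂ / (256 * κ * Real.exp T * γ + 1) := (min_le_right _ _).trans (min_le_right _ _)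
  set a : ℝ := ξ / (2 * ν * γ) + T * ν / 2 with hadef
  have ha0 : 0 ≤ a := by positivity
  set b : ℝ := T * δ₀ + 2 * N * Cd with hbdef
  have hb0 : 0 ≤ b := by positivity
  set c : ℝ := T * (ω₂ + 8 * γ ^ 2 / N ^ 2) * δ₀ ^ 2 with hcdef
  have hc0 : 0 ≤ c := by positivity
  set K₀ : ℝ := 1 + 4 * N * (1 / 4 + 2 / β) + 16 * ω₂ * N ^ 3 * Cd₀ ^ 2 +
    32 * (4 * κ * b ^ 2 + 2 * κ * Real.exp T * c / ω₂) with hK₀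
  have hK₀1 : 1 ≤ K₀ := by
    rw [hK₀]
    have : 0 ≤ 4 * N * (1 / 4 + 2 / β) + 16 * ω₂ * N ^ 3 * Cd₀ ^ 2 +
      32 * (4 * κ * b ^ 2 + 2 * κ * Real.exp T * c / ω₂) := by positivity
    linarith
  -- the two smallness facts
  have h4a : 4 * κ * a ^ 2 ≤ 1 / 32 := pinning_small_a hκ0 hγ hT hν hξ0.le hξ1 hξ2
  have hξE : 8 * κ * Real.exp T * γ * ξ / (ω₂ * N ^ 2) ≤ 1 / 32 := pinning_small_ξ hκ0 hγ hω hN' hξ3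
  refine ⟨K₀, ξ, hK₀1, hξ0, ?_⟩
  intro K hK x hx1 hx2 hreg η hη hM
  have hK1 : 1 ≤ K := hK₀1.trans hK
  have hK0 : 0 < K := by linarith
  have hKK : K ≤ K ^ 2 := by nlinarith
  have hpos₀ : 0 ≤ 4 * N * (1 / 4 + 2 / β) := by positivity
  have hpos₁ : 0 ≤ 16 * ω₂ * N ^ 3 * Cd₀ ^ 2 := by positivity
  have hpos₂ : 0 ≤ 32 * (4 * κ * b ^ 2 + 2 * κ * Real.exp T * c / ω₂) := by positivity
  have hK₂ : 4 * N * (1 / 4 + 2 / β) ≤ K ^ 2 := by rw [hK₀] at hK; linarith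
  have hK₃ : 16 * ω₂ * N ^ 3 * Cd₀ ^ 2 ≤ K ^ 2 := by rw [hK₀] at hK; linarith
  have hKc : 32 * (4 * κ * b ^ 2 + 2 * κ * Real.exp T * c / ω₂) ≤ K := by rw [hK₀] at hK; linarith
  -- the flow, its smooth part and the derivatives
  set P := pinnedChain ω₂ 0 β γ with hP
  set Y := P.drift N with hYdef
  set z := P.chainFlow N x η with hz
  have hUd : Differentiable ℝ P.U := (pinnedChain_contDiff_U ω₂ 0 β γ (n := 1)).differentiable one_ne_zero
  have hVd : Differentiable ℝ P.V := (pinnedChain_contDiff_V ω₂ 0 β γ (n := 1)).differentiable one_ne_zero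
  have hYc : Continuous Y := (pinnedChain_contDiff_drift ω₂ 0 β γ N (n := 0)).continuous
  have hzc : Continuous z := pinnedChain_continuous_chainFlow hω le_rfl hβ.le hγ.le N x hη
  have hz_eq : ∀ s ∈ Icc 0 T, z s = forcing x η s + ∫ r in (0 : ℝ)..s, Y (z r) :=
    pinnedChain_isIntegralSolutionOn_chainFlow hω le_rfl hβ.le hγ.le N x hη T
  set y : ℝ → PhaseSpace N := fun s => x + ∫ r in (0 : ℝ)..s, Y (z r) with hydef
  have hy_deriv : ∀ s, HasDerivAt y (Y (z s)) s := fun s => by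
    have h1 : HasDerivAt (fun u => ∫ r in (0 : ℝ)..u, Y (z r)) (Y (z s)) s :=
      ((hYc.comp hzc).integral_hasStrictDerivAt 0 s).hasDerivAt
    exact h1.const_add x
  have hyc : Continuous y := continuous_iff_continuousAt.2 fun s => (hy_deriv s).continuousAt
  have hy_eq : ∀ s ∈ Icc 0 T, y s = z s - ((0 : Fin N → ℝ), η s) := fun s hs => by
    rw [hz_eq s hs]; simp only [hydef, forcing]; abel
  have hy0 : y 0 = x := by simp [hydef]
  have hzy1 : ∀ s ∈ Icc 0 T, ∀ i, (z s).1 i = (y s).1 i := fun s hs i => by rw [hy_eq s hs]; simp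
  have hzy2 : ∀ s ∈ Icc 0 T, ∀ i, (z s).2 i = (y s).2 i + η s i := fun s hs i => by rw [hy_eq s hs]; simp
  have hq' : ∀ i s, HasDerivAt (fun u => (y u).1 i) ((z s).2 i) s := by
    intro i s
    have h1 := (ContinuousLinearMap.fst ℝ (Fin N → ℝ) (Fin N → ℝ)).hasFDerivAt.comp_hasDerivAt s (hy_deriv s)
    have h2 := (hasDerivAt_pi.1 h1) i
    simpa [hYdef, OscillatorChain.drift] using h2
  have hp' : ∀ i s, HasDerivAt (fun u => (y u).2 i)
      (-(P.dPotential N i (z s).1) - γ * bathWeight N i * (z s).2 i) s := by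
    intro i s
    have h1 := (ContinuousLinearMap.snd ℝ (Fin N → ℝ) (Fin N → ℝ)).hasFDerivAt.comp_hasDerivAt s (hy_deriv s)
    have h2 := (hasDerivAt_pi.1 h1) i
    have hγ' : P.γ = γ := rfl
    simpa [hYdef, OscillatorChain.drift, hγ', P.partialQ_hamiltonian_eq_dPotential hUd hVd] using h2
  -- centre of mass
  set Qb : ℝ → ℝ := fun s => (∑ i, (y s).1 i) / N with hQb
  set Vb : ℝ → ℝ := fun s => (∑ i, (y s).2 i) / N with hVb
  set ηb : ℝ → ℝ := fun s => (∑ i, η s i) / N with hηb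
  set gf : ℝ → ℝ := fun s => -(γ / N) * ∑ i, bathWeight N i * (z s).2 i with hgf
  have hQb' : ∀ s ∈ Icc 0 T, HasDerivAt Qb (Vb s + ηb s) s := by
    intro s hs
    have h1 : HasDerivAt (fun u => ∑ i, (y u).1 i) (∑ i, (z s).2 i) s := HasDerivAt.fun_sum fun i _ => hq' i s
    have h2 := h1.div_const (N : ℝ)
    refine h2.congr_deriv ?_
    simp only [hVb, hηb]
    rw [← add_div, ← Finset.sum_add_distrib]
    congr 1
    exact Finset.sum_congr rfl fun i _ => hzy2 s hs i
  have hVb' : ∀ s ∈ Icc 0 T, HasDerivAt Vb (-ω₂ * Qb s + gf s) s := by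
    intro s hs
    have h1 : HasDerivAt (fun u => ∑ i, (y u).2 i)
        (∑ i, (-(P.dPotential N i (z s).1) - γ * bathWeight N i * (z s).2 i)) s :=
      HasDerivAt.fun_sum fun i _ => hp' i s
    have h2 := h1.div_const (N : ℝ)
    refine h2.congr_deriv ?_
    rw [Finset.sum_sub_distrib, Finset.sum_neg_distrib, hP, pinnedChain_sum_dPotential_harmonic]
    have h3 : ∑ i, ((pinnedChain ω₂ 0 β γ).chainFlow N x η s).1 i = ∑ i, (y s).1 i :=
      Finset.sum_congr rfl fun i _ => hzy1 s hs i
    have h4 : ∑ i, γ * bathWeight N i * ((pinnedChain ω₂ 0 β γ).chainFlow N x η s).2 i =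
        γ * ∑ i, bathWeight N i * ((pinnedChain ω₂ 0 β γ).chainFlow N x η s).2 i := by
      rw [Finset.mul_sum]; exact Finset.sum_congr rfl fun i _ => by ring
    rw [h3, h4]
    simp only [hQb, hgf, hz, hP]
    field_simp
    ring
  -- (1) bounds on the window
  have hwb := fun s (hs : s ∈ Icc 0 T) =>
    pinnedChain_window_bounds hω le_rfl hβ hγ.le N hK1 x hx2 hη hδ₁ hM hAδ hs
  have hybar : ∀ s ∈ Icc 0 T, ∀ i, |(y s).2 i| ≤ (c₁ + 1 / 2) * K ^ 2 := fun s hs i => by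
    have := (hwb s hs).1 i
    rwa [← hy_eq s hs] at this
  have hbd : ∀ s ∈ Icc 0 T, ∀ i : Fin N, ∀ h : i.val + 1 < N,
      |(y s).1 ⟨i.val + 1, h⟩ - (y s).1 i| ≤ Cd * K := fun s hs i h => by
    have := (hwb s hs).2.2 i h
    rwa [hzy1 s hs, hzy1 s hs] at this
  have hηi : ∀ s ∈ Icc 0 T, ∀ i, |η s i| ≤ δ₀ * K := fun s hs i =>
    (show |η s i| ≤ ‖η s‖ by rw [← Real.norm_eq_abs]; exact norm_le_pi_norm (η s) i).trans (hM s hs)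
  have hw0 : ∀ i, 0 ≤ bathWeight N i := fun i => by unfold bathWeight; split_ifs <;> norm_num
  have hw1 : 1 ≤ bathWeight N ⟨0, hN⟩ := by
    unfold bathWeight; simp only [if_true]; split_ifs <;> norm_num
  -- (2) the dissipation integral; argue by contradiction
  set I : ℝ := ∫ s in (0 : ℝ)..T, ∑ i, bathWeight N i * (z s - ((0 : Fin N → ℝ), η s)).2 i ^ 2 with hI
  have hIc : Continuous fun s => ∑ i, bathWeight N i * (z s - ((0 : Fin N → ℝ), η s)).2 i ^ 2 := by
    have hc1 : Continuous fun s => z s - ((0 : Fin N → ℝ), η s) := hzc.sub (continuous_const.prodMk hη)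
    exact continuous_finsetSum _ fun i _ =>
      continuous_const.mul (((continuous_apply i).comp (continuous_snd.comp hc1)).pow 2)
  have hInn : ∀ s, 0 ≤ ∑ i, bathWeight N i * (z s - ((0 : Fin N → ℝ), η s)).2 i ^ 2 := fun s =>
    Finset.sum_nonneg fun i _ => mul_nonneg (hw0 i) (sq_nonneg _)
  have hI0 : 0 ≤ I := intervalIntegral.integral_nonneg hT.le fun s _ => hInn s
  by_contra hcon
  have hIξ : γ * I < ξ * K ^ 4 := lt_of_not_ge hcon
  have hIξ' : I < ξ * K ^ 4 / γ := by rw [lt_div_iff₀ hγ]; linarith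
  -- on `[0, T]` the integrand is `∑ w ȳ²` with `ȳ = (y s).2`
  have hyI : ∀ s ∈ Icc 0 T, ∑ i, bathWeight N i * (z s - ((0 : Fin N → ℝ), η s)).2 i ^ 2 =
      ∑ i, bathWeight N i * (y s).2 i ^ 2 := fun s hs => by rw [← hy_eq s hs]
  -- (3) the linear energy estimate for the centre of mass against the free oscillator
  set D₁ : ℝ → ℝ := fun s => Qb s - oscQ ω (Qb 0) (Vb 0) s with hD₁
  set D₂ : ℝ → ℝ := fun s => Vb s - oscV ω (Qb 0) (Vb 0) s with hD₂
  have hQbc : Continuous Qb := by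
    simp only [hQb]
    exact (continuous_finsetSum _ fun i _ => (continuous_apply i).comp (continuous_fst.comp hyc)).div_const _
  have hVbc : Continuous Vb := by
    simp only [hVb]
    exact (continuous_finsetSum _ fun i _ => (continuous_apply i).comp (continuous_snd.comp hyc)).div_const _
  have hηbc : Continuous ηb := by
    simp only [hηb]
    exact (continuous_finsetSum _ fun i _ => (continuous_apply i).comp hη).div_const _
  have hgfc : Continuous gf := by
    simp only [hgf]
    exact continuous_const.mul (continuous_finsetSum _ fun i _ =>
      continuous_const.mul ((continuous_apply i).comp (continuous_snd.comp hzc)))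
  have hD₁c : Continuous D₁ := hQbc.sub (continuous_oscQ ω _ _)
  have hD₂c : Continuous D₂ := hVbc.sub (continuous_oscV ω _ _)
  have hD₁' : ∀ s ∈ Icc 0 T, HasDerivAt D₁ (D₂ s + ηb s) s := fun s hs => by
    have h := (hQb' s hs).sub (hasDerivAt_oscQ ω (Qb 0) (Vb 0) hωpos.ne' s)
    refine h.congr_deriv ?_
    simp only [hD₂]; ring
  have hD₂' : ∀ s ∈ Icc 0 T, HasDerivAt D₂ (-ω₂ * D₁ s + gf s) s := fun s hs => by
    have h := (hVb' s hs).sub (hasDerivAt_oscV ω (Qb 0) (Vb 0) s)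
    refine h.congr_deriv ?_
    simp only [hD₁]; rw [hω2]; ring
  have hE := linear_energy_estimate hω.le hT.le hηbc hgfc hD₁c hD₂c hD₁' hD₂'
    (by simp [hD₁]) (by simp [hD₂])
  -- the forcing of the linear system is small: `∫₀ᵀ (ω₂η̄² + g²) ≤ cK² + 4γ²I/N²`
  have hforc : ∀ s ∈ Icc 0 T, ω₂ * ηb s ^ 2 + gf s ^ 2 ≤
      (ω₂ + 8 * γ ^ 2 / N ^ 2) * δ₀ ^ 2 * K ^ 2 + 4 * γ ^ 2 / N ^ 2 * ∑ i, bathWeight N i * (y s).2 i ^ 2 := by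
    intro s hs
    have h1 : |ηb s| ≤ δ₀ * K := by
      simp only [hηb]
      rw [abs_div, abs_of_pos hN', div_le_iff₀ hN']
      calc |∑ i, η s i| ≤ ∑ i, |η s i| := Finset.abs_sum_le_sum_abs _ _
        _ ≤ ∑ _i : Fin N, δ₀ * K := Finset.sum_le_sum fun i _ => hηi s hs i
        _ = δ₀ * K * N := by simp; ring
    have h2 : ηb s ^ 2 ≤ (δ₀ * K) ^ 2 := by rw [← sq_abs]; exact pow_le_pow_left₀ (abs_nonneg _) h1 2
    have h3 : (∑ i, bathWeight N i * (z s).2 i) ^ 2 ≤ 2 * ∑ i, bathWeight N i * (z s).2 i ^ 2 :=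
      sq_sum_bathWeight_mul_le hN _
    have h4 : ∑ i, bathWeight N i * (z s).2 i ^ 2 ≤ 2 * ∑ i, bathWeight N i * (y s).2 i ^ 2 + 4 * (δ₀ * K) ^ 2 := by
      have h5 : ∀ i, bathWeight N i * (z s).2 i ^ 2 ≤ bathWeight N i * (2 * (y s).2 i ^ 2 + 2 * (δ₀ * K) ^ 2) := by
        intro i
        refine mul_le_mul_of_nonneg_left ?_ (hw0 i)
        rw [hzy2 s hs i]
        have hη2 : η s i ^ 2 ≤ (δ₀ * K) ^ 2 := by rw [← sq_abs]; exact pow_le_pow_left₀ (abs_nonneg _) (hηi s hs i) 2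
        nlinarith [sq_nonneg ((y s).2 i - η s i)]
      calc ∑ i, bathWeight N i * (z s).2 i ^ 2 ≤ ∑ i, bathWeight N i * (2 * (y s).2 i ^ 2 + 2 * (δ₀ * K) ^ 2) :=
            Finset.sum_le_sum fun i _ => h5 i
        _ = 2 * ∑ i, bathWeight N i * (y s).2 i ^ 2 + (∑ i, bathWeight N i) * (2 * (δ₀ * K) ^ 2) := by
            rw [Finset.mul_sum, Finset.sum_mul, ← Finset.sum_add_distrib]
            exact Finset.sum_congr rfl fun i _ => by ring
        _ = 2 * ∑ i, bathWeight N i * (y s).2 i ^ 2 + 4 * (δ₀ * K) ^ 2 := by rw [sum_bathWeight hN]; ring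
    have h6 : gf s ^ 2 = (γ / N) ^ 2 * (∑ i, bathWeight N i * (z s).2 i) ^ 2 := by simp only [hgf]; ring
    rw [h6]
    have h7 : (γ / N) ^ 2 * (∑ i, bathWeight N i * (z s).2 i) ^ 2 ≤
        (γ / N) ^ 2 * (2 * (2 * ∑ i, bathWeight N i * (y s).2 i ^ 2 + 4 * (δ₀ * K) ^ 2)) :=
      mul_le_mul_of_nonneg_left (h3.trans (by linarith)) (by positivity)
    have h8 : (γ / N) ^ 2 * (2 * (2 * ∑ i, bathWeight N i * (y s).2 i ^ 2 + 4 * (δ₀ * K) ^ 2)) =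
        8 * γ ^ 2 / N ^ 2 * δ₀ ^ 2 * K ^ 2 + 4 * γ ^ 2 / N ^ 2 * ∑ i, bathWeight N i * (y s).2 i ^ 2 := by
      field_simp
      ring
    rw [h8] at h7
    have h9 := mul_le_mul_of_nonneg_left h2 hω.le
    linarith only [h7, h9]
  have hforcI : ∫ s in (0 : ℝ)..T, (ω₂ * ηb s ^ 2 + gf s ^ 2) ≤ c * K ^ 2 + 4 * γ ^ 2 / N ^ 2 * I := by
    have h1 : ∫ s in (0 : ℝ)..T, (ω₂ * ηb s ^ 2 + gf s ^ 2) ≤ ∫ s in (0 : ℝ)..T,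
        ((ω₂ + 8 * γ ^ 2 / N ^ 2) * δ₀ ^ 2 * K ^ 2 + 4 * γ ^ 2 / N ^ 2 *
          ∑ i, bathWeight N i * (z s - ((0 : Fin N → ℝ), η s)).2 i ^ 2) := by
      refine intervalIntegral.integral_mono_on hT.le ?_ ?_ fun s hs => ?_
      · exact ((hηbc.pow 2).const_mul ω₂ |>.add (hgfc.pow 2)).intervalIntegrable _ _
      · exact (continuous_const.add (hIc.const_mul _)).intervalIntegrable _ _
      · rw [hyI s hs]; exact hforc s hs
    rw [intervalIntegral.integral_add (continuous_const.intervalIntegrable _ _) ((hIc.const_mul _).intervalIntegrable _ _),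
      intervalIntegral.integral_const, intervalIntegral.integral_const_mul, sub_zero, smul_eq_mul] at h1
    rw [hcdef]
    linarith
  set Eb : ℝ := Real.exp T / ω₂ * (c * K ^ 2 + 4 * γ * ξ * K ^ 4 / N ^ 2) with hEb
  have hD₁sq : ∀ t ∈ Icc 0 T, D₁ t ^ 2 ≤ Eb := by
    intro t ht
    have h1 := hE t ht
    have h2 : ω₂ * D₁ t ^ 2 ≤ Real.exp T * (c * K ^ 2 + 4 * γ ^ 2 / N ^ 2 * I) := by
      have := mul_le_mul_of_nonneg_left hforcI (Real.exp_pos T).le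
      linarith only [h1, this, sq_nonneg (D₂ t)]
    have h3 : 4 * γ ^ 2 / N ^ 2 * I ≤ 4 * γ * ξ * K ^ 4 / N ^ 2 := by
      have := mul_le_mul_of_nonneg_left hIξ'.le (by positivity : 0 ≤ 4 * γ ^ 2 / N ^ 2)
      refine this.trans (le_of_eq ?_)
      field_simp
    have h5 : ω₂ * D₁ t ^ 2 ≤ Real.exp T * (c * K ^ 2 + 4 * γ * ξ * K ^ 4 / N ^ 2) :=
      h2.trans (mul_le_mul_of_nonneg_left (by linarith only [h3]) (Real.exp_pos T).le)
    calc D₁ t ^ 2 = ω₂ * D₁ t ^ 2 / ω₂ := by field_simp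
      _ ≤ Real.exp T * (c * K ^ 2 + 4 * γ * ξ * K ^ 4 / N ^ 2) / ω₂ := div_le_div_of_nonneg_right h5 hω.le
      _ = Eb := by rw [hEb]; ring
  -- (4) displacement of `q₀` and of the centre of mass
  set μ : ℝ := ν * K ^ 2 with hμ
  have hμ0 : 0 < μ := by positivity
  have hq0 : ∀ t ∈ Icc 0 T, |(y t).1 ⟨0, hN⟩ - (y 0).1 ⟨0, hN⟩| ≤ I / (2 * μ) + T * (μ / 2 + δ₀ * K) := by
    intro t ht
    have hzc0 : Continuous fun s => (z s).2 ⟨0, hN⟩ := (continuous_apply _).comp (continuous_snd.comp hzc)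
    have hFTC := intervalIntegral.integral_eq_sub_of_hasDerivAt (fun s _ => hq' ⟨0, hN⟩ s)
      (hzc0.intervalIntegrable 0 t)
    rw [← hFTC]
    have hpt : ∀ s ∈ Icc 0 T, |(z s).2 ⟨0, hN⟩| ≤
        (∑ i, bathWeight N i * (z s - ((0 : Fin N → ℝ), η s)).2 i ^ 2) / (2 * μ) + (μ / 2 + δ₀ * K) := by
      intro s hs
      rw [hzy2 s hs, hyI s hs]
      have h1 : |(y s).2 ⟨0, hN⟩| ≤ (y s).2 ⟨0, hN⟩ ^ 2 / (2 * μ) + μ / 2 := by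
        rw [div_add_div _ _ (by positivity) two_ne_zero, le_div_iff₀ (by positivity)]
        nlinarith [sq_nonneg (|(y s).2 ⟨0, hN⟩| - μ), sq_abs ((y s).2 ⟨0, hN⟩)]
      have h2 : (y s).2 ⟨0, hN⟩ ^ 2 ≤ ∑ i, bathWeight N i * (y s).2 i ^ 2 := by
        calc (y s).2 ⟨0, hN⟩ ^ 2 ≤ bathWeight N ⟨0, hN⟩ * (y s).2 ⟨0, hN⟩ ^ 2 := by
              nlinarith [sq_nonneg ((y s).2 ⟨0, hN⟩)]
          _ ≤ ∑ i, bathWeight N i * (y s).2 i ^ 2 :=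
              Finset.single_le_sum (f := fun i => bathWeight N i * (y s).2 i ^ 2)
                (fun i _ => mul_nonneg (hw0 i) (sq_nonneg _)) (Finset.mem_univ _)
      have h3 : (y s).2 ⟨0, hN⟩ ^ 2 / (2 * μ) ≤ (∑ i, bathWeight N i * (y s).2 i ^ 2) / (2 * μ) :=
        div_le_div_of_nonneg_right h2 (by positivity)
      calc |(y s).2 ⟨0, hN⟩ + η s ⟨0, hN⟩| ≤ |(y s).2 ⟨0, hN⟩| + |η s ⟨0, hN⟩| := abs_add_le _ _
        _ ≤ ((y s).2 ⟨0, hN⟩ ^ 2 / (2 * μ) + μ / 2) + δ₀ * K := add_le_add h1 (hηi s hs _)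
        _ ≤ _ := by linarith
    have hint := intervalIntegral.norm_integral_le_integral_norm (μ := volume) (f := fun s => (z s).2 ⟨0, hN⟩) ht.1
    rw [Real.norm_eq_abs] at hint
    refine hint.trans ?_
    have hmono : ∫ s in (0 : ℝ)..t, ‖(z s).2 ⟨0, hN⟩‖ ≤ ∫ s in (0 : ℝ)..t,
        ((∑ i, bathWeight N i * (z s - ((0 : Fin N → ℝ), η s)).2 i ^ 2) / (2 * μ) + (μ / 2 + δ₀ * K)) := by
      refine intervalIntegral.integral_mono_on ht.1 (hzc0.norm.intervalIntegrable _ _)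
        (((hIc.div_const _).add continuous_const).intervalIntegrable _ _) fun s hs => ?_
      rw [Real.norm_eq_abs]
      exact hpt s ⟨hs.1, hs.2.trans ht.2⟩
    refine hmono.trans ?_
    rw [intervalIntegral.integral_add ((hIc.div_const _).intervalIntegrable _ _) (continuous_const.intervalIntegrable _ _),
      intervalIntegral.integral_const, sub_zero, smul_eq_mul, intervalIntegral.integral_div]
    have hIt : ∫ s in (0 : ℝ)..t, ∑ i, bathWeight N i * (z s - ((0 : Fin N → ℝ), η s)).2 i ^ 2 ≤ I :=
      intervalIntegral.integral_mono_interval le_rfl ht.1 ht.2 (Eventually.of_forall hInn) (hIc.intervalIntegrable _ _)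
    have h5 : (∫ s in (0 : ℝ)..t, ∑ i, bathWeight N i * (z s - ((0 : Fin N → ℝ), η s)).2 i ^ 2) / (2 * μ) ≤ I / (2 * μ) :=
      div_le_div_of_nonneg_right hIt (by positivity)
    have h6 : t * (μ / 2 + δ₀ * K) ≤ T * (μ / 2 + δ₀ * K) := mul_le_mul_of_nonneg_right ht.2 (by positivity)
    linarith only [h5, h6]
  have hQdisp : ∀ t ∈ Icc 0 T, |Qb t - Qb 0| ≤ K ^ 2 * a + K * b := by
    intro t ht
    have h0 : (0 : ℝ) ∈ Icc 0 T := ⟨le_rfl, hT.le⟩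
    have h1 := abs_mean_sub_head_le hN (by positivity) (hbd t ht)
    have h2 := abs_mean_sub_head_le hN (by positivity) (hbd 0 h0)
    have h3 := hq0 t ht
    have h4 : |Qb t - Qb 0| ≤ N * (Cd * K) + (I / (2 * μ) + T * (μ / 2 + δ₀ * K)) + N * (Cd * K) := by
      have e : Qb t - Qb 0 = ((∑ i, (y t).1 i) / N - (y t).1 ⟨0, hN⟩) +
          ((y t).1 ⟨0, hN⟩ - (y 0).1 ⟨0, hN⟩) - ((∑ i, (y 0).1 i) / N - (y 0).1 ⟨0, hN⟩) := by
        simp only [hQb]; ring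
      rw [e]
      calc |((∑ i, (y t).1 i) / N - (y t).1 ⟨0, hN⟩) + ((y t).1 ⟨0, hN⟩ - (y 0).1 ⟨0, hN⟩) -
            ((∑ i, (y 0).1 i) / N - (y 0).1 ⟨0, hN⟩)|
          ≤ |((∑ i, (y t).1 i) / N - (y t).1 ⟨0, hN⟩) + ((y t).1 ⟨0, hN⟩ - (y 0).1 ⟨0, hN⟩)| +
            |(∑ i, (y 0).1 i) / N - (y 0).1 ⟨0, hN⟩| := abs_sub _ _
        _ ≤ (|(∑ i, (y t).1 i) / N - (y t).1 ⟨0, hN⟩| + |(y t).1 ⟨0, hN⟩ - (y 0).1 ⟨0, hN⟩|) +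
            |(∑ i, (y 0).1 i) / N - (y 0).1 ⟨0, hN⟩| := add_le_add (abs_add_le _ _) le_rfl
        _ ≤ (N * (Cd * K) + (I / (2 * μ) + T * (μ / 2 + δ₀ * K))) + N * (Cd * K) :=
            add_le_add (add_le_add h1 h3) h2
    -- `I/(2μ) ≤ K²ξ/(2νγ)` and `Tμ/2 = TνK²/2`
    have h5 : I / (2 * μ) ≤ K ^ 2 * (ξ / (2 * ν * γ)) := by
      rw [hμ, div_le_iff₀ (by positivity)]
      have := hIξ'.le
      have e : K ^ 2 * (ξ / (2 * ν * γ)) * (2 * (ν * K ^ 2)) = ξ * K ^ 4 / γ := by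
        field_simp
      rw [e]
      exact this
    have e2 : K ^ 2 * a + K * b = K ^ 2 * (ξ / (2 * ν * γ)) + T * (ν * K ^ 2 / 2) + T * (δ₀ * K) +
        2 * (N * (Cd * K)) := by
      rw [hadef, hbdef]; ring
    rw [e2]
    have e3 : T * (μ / 2 + δ₀ * K) = T * (ν * K ^ 2 / 2) + T * (δ₀ * K) := by rw [hμ]; ring
    linarith only [h4, h5, e3]
  -- (5) the oscillator must move: contradiction
  set t₁ : ℝ := θ / ω with ht₁
  set t₂ : ℝ := 2 * θ / ω with ht₂
  have ht₁I : t₁ ∈ Icc 0 T := ⟨by positivity, by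
    have : t₁ ≤ t₂ := by rw [ht₁, ht₂]; gcongr; linarith
    exact this.trans hθT⟩
  have ht₂I : t₂ ∈ Icc 0 T := ⟨by positivity, hθT⟩
  have hosc := (osc_data_le hωpos hθ0 hθ1 (Qb 0) (Vb 0)).1
  -- `|f_k| ≤ |Q̄(t_k) - Q̄(0)| + |D₁(t_k)|`
  have hf : ∀ t ∈ Icc 0 T, (oscQ ω (Qb 0) (Vb 0) t - Qb 0) ^ 2 ≤ 2 * (K ^ 2 * a + K * b) ^ 2 + 2 * Eb := by
    intro t ht
    have e : oscQ ω (Qb 0) (Vb 0) t - Qb 0 = (Qb t - Qb 0) - D₁ t := by simp only [hD₁]; ring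
    rw [e]
    have h1 := hQdisp t ht
    have h2 := hD₁sq t ht
    have h3 : (Qb t - Qb 0) ^ 2 ≤ (K ^ 2 * a + K * b) ^ 2 := by
      rw [← sq_abs]; exact pow_le_pow_left₀ (abs_nonneg _) h1 2
    nlinarith only [h2, h3, sq_nonneg ((Qb t - Qb 0) + D₁ t)]
  set Δ : ℝ := K ^ 2 * a + K * b with hΔ
  have hΔ0 : 0 ≤ Δ := by positivity
  have hEb0 : 0 ≤ Eb := by positivity
  have hQsq : (2 * cθ * |Qb 0|) ^ 2 ≤ 9 * (2 * Δ ^ 2 + 2 * Eb) := by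
    have h1 : 2 * cθ * |Qb 0| ≤ |oscQ ω (Qb 0) (Vb 0) (2 * θ / ω) - Qb 0| +
        2 * |oscQ ω (Qb 0) (Vb 0) (θ / ω) - Qb 0| := by
      have := hosc
      rw [le_div_iff₀ (by positivity)] at this
      linarith
    have h2 := hf t₂ ht₂I
    have h3 := hf t₁ ht₁I
    rw [ht₂] at h2; rw [ht₁] at h3
    have h4 : (2 * cθ * |Qb 0|) ^ 2 ≤ (|oscQ ω (Qb 0) (Vb 0) (2 * θ / ω) - Qb 0| +
        2 * |oscQ ω (Qb 0) (Vb 0) (θ / ω) - Qb 0|) ^ 2 :=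
      pow_le_pow_left₀ (by positivity) h1 2
    have h5 := sq_add_two_mul_le |oscQ ω (Qb 0) (Vb 0) (2 * θ / ω) - Qb 0| |oscQ ω (Qb 0) (Vb 0) (θ / ω) - Qb 0|
    rw [sq_abs, sq_abs] at h5
    linarith only [h4, h5, h2, h3, hΔ]
  -- the centre-of-mass energy at time `0`
  have hQ0 : Qb 0 = (∑ i, x.1 i) / N := by simp only [hQb, hy0]
  have hcm := pinnedChain_cm_potential_lower (γ := γ) hω hβ hN hK1 hK₂ hK₃ hx1 hx2 hreg
  rw [← hQ0] at hcm
  -- `K⁴/8 ≤ Nω₂Q̄₀²/2 ≤ κ(2Δ² + 2Eb) < K⁴/8`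
  have hup : N * ω₂ * Qb 0 ^ 2 / 2 ≤ κ * (2 * Δ ^ 2 + 2 * Eb) := by
    have e1 : N * ω₂ * Qb 0 ^ 2 / 2 = (N * ω₂ / (8 * cθ ^ 2)) * (2 * cθ * |Qb 0|) ^ 2 := by
      rw [mul_pow, mul_pow, sq_abs]; field_simp; ring
    rw [e1, hκ]
    have := mul_le_mul_of_nonneg_left hQsq (by positivity : 0 ≤ N * ω₂ / (8 * cθ ^ 2))
    refine this.trans (le_of_eq ?_)
    ring
  have harith := pinning_arith (κ := κ) (a := a) (b := b) (c := c) (ξ := ξ) (γ := γ) (T := T) (Nr := (N : ℝ))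
    hκ0.le hω hK1 hΔ0 h4a hξE hKc le_rfl le_rfl
  linarith only [hcm, hup, harith]

end Main

end Literature.MathematicalPhysics.KineticTheory.HeatConduction
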